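import Summits.BirchSwinnertonDyer.BirchSwinnertonDyer.Theorems.BiquadraticEisensteinDescentEisensteinHeartFlatCMInertBadKPrimeCuspCoeffVanishing
import Literature.NumberTheory.EllipticCurves.RankinSelbergEulerProductHeckeInducedAllPlacesProofs
import Literature.NumberTheory.EllipticCurves.PAdicLFunctionProofs
import Literature.NumberTheory.NumberFields.QuadraticExtensionPlacesProofs
import HarnessLib

set_option linter.dupNamespace false -- `Summit.BirchSwinnertonDyer.BirchSwinnertonDyer.Theorems.…` (summit = sub)
set_option autoImplicit false

/-!
# Crux `EisensteinHeartFlatCMInertBadKPrime` (stmt-BirchSwinnertonDyer-21341), line `hsieh-lambda`, layer 2 (V2),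
# hypothesis (L), LOCAL PART: Deuring's theorem over `ℚ` ⟹ the Euler factors of `L(f/K′, χ, s)` over `K′`
# ("Deuring over `K′`", Silverman II Thm. 10.5 (b) / Ex. 2.32 (a) with `L := K′`, `L′ := K_CM·K′`)

Route `BiquadraticEisensteinDescent` (cell `pub/bsd-wall`, width seat `bsd-wall-cm-bed-w3`). THEOREMS ONLY (no definition,
no named fact, no `sorry`); supports stmt-BirchSwinnertonDyer-21341 as a helper; nothing about the crux's input or any case
of BSD is asserted.

## What is proved

The V2 socket's hypothesis (L) (`…KatzHsiehDisplay.exists_span_C_mul_eq`, `hLval`) was reduced by the Literature files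
`RankinSelbergValueHeckeShiftedContinuationProofs` (analytic glue, from the socket's own (T)) and
`RankinSelbergEulerProductHecke{Induced,InducedAllPlaces}Proofs` (Euler products) to the POLYNOMIAL IDENTITIES

  `(hpoly)  ∀ v ∤ ∞ of K′, ∀ X, 1 − t_v X + e_v^{k_v} X² = ∏_{w ∣ v in L} (1 − η̃(w) X^{f(w|v)})`

in the notation of `rankinSelbergLocalFactorInvHecke f χ v` (`N(v) = ℓ^{k}`, `t_v = α_ℓ^k + β_ℓ^k` for `a_ℓ(f)`, `e_v = ℓ·𝟙_{ℓ∤N}`),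
for `η = ψ ∘ N_{L/K_CM}` (`ψ.compRelNorm L`). Here `hpoly` is PROVED (`polynomial_identity`) for

* `W/ℚ` elliptic, globally minimal, with CM (`W.HasCM`), `f` its newform at level `N_W` (`IsNewformOf W f`);
* `K₁` a number field Galois over `ℚ` (the CM field), `c : K₁ ≃ₐ[ℚ] K₁`, and `ψ : HeckeCharacter K₁` of exponent `−1/2`
  (`‖ψ(x)‖ = ‖x‖^{−1/2}`, i.e. weight `1`) satisfying DEURING'S LOCAL CLAUSES AT THE GOOD PRIMES — verbatim clause (iv) of the
  tree's named fact `Deuring_exists_heckeCharacter_of_maximalCM` (Silverman II Thm. 10.5 (b), Ex. 2.30, Cor. 10.4.1): `ψ`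
  unramified above good `ℓ`, `ψ(𝔮) + ψ(c𝔮) = a_ℓ`, `ψ(𝔮)ψ(c𝔮) = ℓ` if `c𝔮 ≠ 𝔮`, `a_ℓ = 0`, `ψ(𝔮) = −ℓ` if `c𝔮 = 𝔮` — taken
  as a HYPOTHESIS on `ψ` (any `ψ`; the route's `ψ_W` is supplied by the instantiation together with the named fact);
* `K` (`= K′`) quadratic, `L ⊇ K, K₁` with `L/K` quadratic Galois, a non-trivial `τ ∈ Gal(L/K)` acting on `K₁` as `c`
  (`(τ|_ℚ)|_{K₁} = c` — the biquadratic `L = K_CM·K′`);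
* three frame-level side conditions, each a one-line property of the route's data: (hψbad) `η` is RAMIFIED above every bad
  prime of `W` (Heegner: bad primes split in `K′`, so `e(w|𝔮) = 1`, and `ψ` is ramified there — `…BranchRamification` at `p`);
  (hdeg) a prime of `K` INERT in `L/K` has residue degree `1` over `ℚ` (no residue degree `4` in the biquadratic field);
  (hramL) `L/K` ramifies only above BAD primes of `W` (`L = K′(√d_CM)` ramifies only above `d_CM`, whose primes are bad).

Case analysis (`polynomial_identity`): `{w ∣ v} = {w, τw}` (`QuadraticExtensionPlacesProofs`); bad `ℓ`: both sides are `1`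
(`a_ℓ(f) = 0`, `e_v = 0`; `η̃ = 0`); good `ℓ`, two places (`f(w|v) = 1`): traces `𝔮, c𝔮` on `K₁` (`(τw) ∩ K₁ = c • (w ∩ K₁)`),
`η̃(w) = ψ(𝔮)^{f(w|𝔮)}` (`compRelNorm_valueAtUniformizer_eq_pow`, all places), `N(𝔮) = ℓ` or `ℓ²` read off `|ψ(𝔮)| = N(𝔮)^{1/2}`,
and Newton's identity `α^k + β^k = frobTracePow (α+β) (αβ) k`; good `ℓ`, one place: `f(w|v) = 2`, `k = 1`, `c𝔮 = 𝔮`,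
`1 + ℓX² = 1 − (−ℓ)X²`.

References: [SilvermanATAEC1994] Ch. II Thm. 10.5 (b), Cor. 10.4.1, Ex. 2.30–2.32 (pp. 171–179); [NeukirchANT1999] Ch. I §8–9,
Ch. VII (10.4)(iv); [Nekovar1995] (0.5), §3.4 (the local factors of `L(f ⊗ K, 𝒲, s)`).
-/

noncomputable section

open scoped NumberField Pointwise
open NumberField IsDedekindDomain Ideal Complex CongruenceSubgroup WeierstrassCurve
open Literature.NumberTheory.GaloisRepresentations Literature.NumberTheory.EllipticCurves
open Literature.NumberTheory.EllipticCurves.ModularForms Literature.NumberTheory.NumberFields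
open Literature.NumberTheory.Automorphic
open Summit.BirchSwinnertonDyer.BirchSwinnertonDyer.Theorems.BiquadraticEisensteinDescentEisensteinHeartFlatCMInertBadKPrimeCuspCoeffVanishing

namespace Summit.BirchSwinnertonDyer.BirchSwinnertonDyer.Theorems.BiquadraticEisensteinDescentEisensteinHeartFlatCMInertBadKPrimeDeuringOverKPrime

/-! ### §1 Newton power sums -/

/-- `frobTracePow (α + β) (αβ) k = α^k + β^k` (Newton's recursion). [folklore] -/
theorem frobTracePow_eq_pow_add_pow (α β : ℂ) : ∀ k : ℕ, frobTracePow (α + β) (α * β) k = α ^ k + β ^ k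
  | 0 => by rw [frobTracePow_zero]; norm_num
  | 1 => by rw [frobTracePow_one, pow_one, pow_one]
  | k + 2 => by
    rw [frobTracePow, frobTracePow_eq_pow_add_pow α β (k + 1), frobTracePow_eq_pow_add_pow α β k]
    ring

/-- `frobTracePow 0 0 k = 0` for `k ≥ 1`. [folklore] -/
theorem frobTracePow_zero_zero {k : ℕ} (hk : 0 < k) : frobTracePow 0 0 k = 0 := by
  have h := frobTracePow_eq_pow_add_pow 0 0 k
  rw [add_zero, mul_zero, zero_pow hk.ne', add_zero] at h
  exact h

/-! ### §2 Bookkeeping: rational primes in finite places -/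

section Places

variable {K L : Type} [Field K] [NumberField K] [Field L] [NumberField L] [Algebra K L]

omit [NumberField K] [NumberField L] in
/-- `n ∈ v ↔ n ∈ w` for `w ∣ v` and a natural number `n`. [folklore] -/
theorem natCast_mem_iff_of_under_eq {w : HeightOneSpectrum (𝓞 L)} {v : HeightOneSpectrum (𝓞 K)}
    (hw : w.under (𝓞 K) = v) (n : ℕ) : (n : 𝓞 K) ∈ v.asIdeal ↔ (n : 𝓞 L) ∈ w.asIdeal := by
  rw [← hw, HeightOneSpectrum.under_asIdeal, Ideal.under_def, Ideal.mem_comap, map_natCast]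

/-- `N(v) = ℓ^k` with `ℓ = N(v).minFac ∈ v` prime and `1 ≤ k ≤ [K:ℚ]`, `k` the `factorization` exponent.
[cite: NeukirchANT1999, Ch. I §8 (8.2)–(8.3)] -/
theorem minFac_mem (v : HeightOneSpectrum (𝓞 K)) : ((Ideal.absNorm v.asIdeal).minFac : 𝓞 K) ∈ v.asIdeal := by
  obtain ⟨k, _, _, hℓ, hN, _⟩ := absNorm_heightOneSpectrum_eq_pow v
  have h1 : ((Ideal.absNorm v.asIdeal : ℕ) : 𝓞 K) ∈ v.asIdeal := Ideal.absNorm_mem v.asIdeal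
  rw [hN, Nat.cast_pow] at h1
  exact Ideal.IsPrime.mem_of_pow_mem v.isPrime _ h1

end Places

/-! ### §3 Reading `N(𝔮)` off `|ψ(𝔮)| = N(𝔮)^{1/2}` -/

section Norms

variable {K₁ : Type} [Field K₁] [NumberField K₁]

/-- For `ψ` of exponent `−1/2`: `‖ψ(𝔮)‖ = N(𝔮)^{1/2}`. [cite: WeilBNT1967, Ch. VII §7 (first paragraph)] -/
theorem norm_valueAtUniformizer_eq_sqrt {ψ : HeckeCharacter K₁}
    (hψσ : ∀ x : ideleGroup K₁, ‖((ψ x : ℂˣ) : ℂ)‖ = ideleNorm x ^ (-(1 / 2 : ℝ))) (𝔮 : HeightOneSpectrum (𝓞 K₁)) :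
    ‖ψ.valueAtUniformizer 𝔮‖ = ((Ideal.absNorm 𝔮.asIdeal : ℕ) : ℝ) ^ (1 / 2 : ℝ) := by
  rw [HeckeCharacter.norm_valueAtUniformizer_of_norm_eq_rpow hψσ, neg_neg]

/-- If `‖z‖ = N^{1/2}` and `‖z'‖ = N^{1/2}` with `z z' = ℓ` then `N = ℓ`. [folklore] -/
theorem absNorm_eq_of_mul_eq {N ℓ : ℕ} {z z' : ℂ} (hz : ‖z‖ = (N : ℝ) ^ (1 / 2 : ℝ)) (hz' : ‖z'‖ = (N : ℝ) ^ (1 / 2 : ℝ))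
    (h : z * z' = ℓ) : N = ℓ := by
  have h2 : ‖z * z'‖ = (ℓ : ℝ) := by rw [h, Complex.norm_natCast]
  rw [norm_mul, hz, hz', ← Real.rpow_add' (Nat.cast_nonneg _) (by norm_num), show (1 / 2 : ℝ) + 1 / 2 = 1 by norm_num,
    Real.rpow_one] at h2
  exact_mod_cast h2

/-- If `‖z‖ = N^{1/2}` and `z = −ℓ` then `N = ℓ²`. [folklore] -/
theorem absNorm_eq_sq_of_eq_neg {N ℓ : ℕ} {z : ℂ} (hz : ‖z‖ = (N : ℝ) ^ (1 / 2 : ℝ)) (h : z = -(ℓ : ℂ)) : N = ℓ ^ 2 := by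
  have h2 : ‖z‖ ^ 2 = (ℓ : ℝ) ^ 2 := by rw [h, norm_neg, Complex.norm_natCast]
  rw [hz, ← Real.rpow_natCast, ← Real.rpow_mul (Nat.cast_nonneg _), show (1 / 2 : ℝ) * (2 : ℕ) = 1 by norm_num,
    Real.rpow_one] at h2
  exact_mod_cast h2

end Norms

/-! ### §4 Deuring over `K′`: the polynomial identities -/

section Main

variable {K₁ K L : Type} [Field K₁] [NumberField K₁] [Field K] [NumberField K] [Field L] [NumberField L]
  [Algebra K₁ L] [IsGalois K₁ L] [Algebra K L] [IsGalois K L] [IsGalois ℚ K₁]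

/-- **DEURING OVER `K′` — the local polynomial identities `hpoly` of hypothesis (L).** See the module docstring for the
data and the three side conditions. For every finite place `v` of `K` and every `X`,
`1 − t_v X + e_v^{k_v} X² = ∏ᶠ_{w ∣ v} (1 − η̃(w) X^{f(w|v)})` with `η = ψ.compRelNorm L`, in the literal notation of
`rankinSelbergLocalFactorInvHecke f χ v` — the hypothesis `hpoly` of `hEP_of_polynomial_identities'` /
`heckeLFunction_mul_compRelNorm_eq_rankinSelbergEulerProductHecke'`.
[cite: SilvermanATAEC1994, Ch. II Thm. 10.5 (b), Cor. 10.4.1 and Ex. 2.30–2.32 (pp. 171–179)] [cite: NeukirchANT1999, Ch. VII (10.4)(iv)] -/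
theorem polynomial_identity (W : WeierstrassCurve ℚ) [W.IsElliptic] [W.IsGloballyMinimal] [NeZero (W.conductorNorm ℤ)]
    (hCM : W.HasCM) (c : K₁ ≃ₐ[ℚ] K₁) {ψ : HeckeCharacter K₁}
    (hψσ : ∀ x : ideleGroup K₁, ‖((ψ x : ℂˣ) : ℂ)‖ = ideleNorm x ^ (-(1 / 2 : ℝ)))
    (hψgood : ∀ (ℓ : ℕ) [Fact ℓ.Prime], W.HasGoodReductionAtPrime ℓ →
      ∀ 𝔮 : HeightOneSpectrum (𝓞 K₁), (ℓ : 𝓞 K₁) ∈ 𝔮.asIdeal →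
        ψ.IsUnramifiedAt 𝔮 ∧
        (c • 𝔮 ≠ 𝔮 →
          ψ.valueAtUniformizer 𝔮 + ψ.valueAtUniformizer (c • 𝔮) = (W.frobeniusTrace ℓ : ℂ) ∧
          ψ.valueAtUniformizer 𝔮 * ψ.valueAtUniformizer (c • 𝔮) = (ℓ : ℂ)) ∧
        (c • 𝔮 = 𝔮 → W.frobeniusTrace ℓ = 0 ∧ ψ.valueAtUniformizer 𝔮 = -(ℓ : ℂ)))
    (hψbad : ∀ (ℓ : ℕ) [Fact ℓ.Prime], ¬ W.HasGoodReductionAtPrime ℓ →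
      ∀ w : HeightOneSpectrum (𝓞 L), (ℓ : 𝓞 L) ∈ w.asIdeal → ¬ (ψ.compRelNorm L).IsUnramifiedAt w)
    {f : CuspForm (Gamma0 (W.conductorNorm ℤ)) 2} (hf : IsNewformOf W f)
    (h2K : Module.finrank ℚ K = 2) (h2L : Module.finrank K L = 2) {τ : L ≃ₐ[K] L} (hτ : τ ≠ 1)
    (hτc : (τ.restrictScalars ℚ).restrictNormal K₁ = c)
    (hdeg : ∀ (w : HeightOneSpectrum (𝓞 L)) (v : HeightOneSpectrum (𝓞 K)), w.under (𝓞 K) = v →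
      w.asIdeal.inertiaDeg (𝓞 K) = 2 → Ideal.absNorm v.asIdeal = (Ideal.absNorm v.asIdeal).minFac)
    (hramL : ∀ (ℓ : ℕ) [Fact ℓ.Prime] (w : HeightOneSpectrum (𝓞 L)) (v : HeightOneSpectrum (𝓞 K)), w.under (𝓞 K) = v →
      (ℓ : 𝓞 K) ∈ v.asIdeal → w.asIdeal.ramificationIdx (𝓞 K) = 2 → ¬ W.HasGoodReductionAtPrime ℓ)
    (v : HeightOneSpectrum (𝓞 K)) (X : ℂ) :
    1 - frobTracePow (cuspCoeff f (Ideal.absNorm v.asIdeal).minFac)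
          (if (Ideal.absNorm v.asIdeal).minFac ∣ W.conductorNorm ℤ then 0 else ((Ideal.absNorm v.asIdeal).minFac : ℂ))
          ((Ideal.absNorm v.asIdeal).factorization (Ideal.absNorm v.asIdeal).minFac) * X +
      (if (Ideal.absNorm v.asIdeal).minFac ∣ W.conductorNorm ℤ then 0 else ((Ideal.absNorm v.asIdeal).minFac : ℂ)) ^
          ((Ideal.absNorm v.asIdeal).factorization (Ideal.absNorm v.asIdeal).minFac) * X ^ 2 =
    ∏ᶠ w ∈ {w : HeightOneSpectrum (𝓞 L) | w.under (𝓞 K) = v},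
      (1 - heckeValueExtZero (ψ.compRelNorm L) w * X ^ w.asIdeal.inertiaDeg (𝓞 K)) := by
  classical
  -- the rational prime `ℓ` below `v`, `N(v) = ℓ^k`
  obtain ⟨k, hk0, hk2, hℓ, hNv, hfac⟩ := absNorm_heightOneSpectrum_eq_pow v
  set q : ℕ := Ideal.absNorm v.asIdeal with hq
  set ℓ : ℕ := q.minFac with hℓdef
  haveI : Fact ℓ.Prime := ⟨hℓ⟩
  rw [hfac]
  rw [h2K] at hk2
  have hℓv : (ℓ : 𝓞 K) ∈ v.asIdeal := minFac_mem v
  -- a place `w ∣ v`; the fibre is `{w, τw}`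
  obtain ⟨w, hw⟩ : ∃ w : HeightOneSpectrum (𝓞 L), w.under (𝓞 K) = v :=
    HeightOneSpectrum.under_surjective (A := 𝓞 K) (B := 𝓞 L) v
  have hw' : (τ • w).under (𝓞 K) = v := by rw [HeightOneSpectrum.under_algEquiv_smul, hw]
  have hℓw : (ℓ : 𝓞 L) ∈ w.asIdeal := (natCast_mem_iff_of_under_eq hw ℓ).mp hℓv
  have hℓw' : (ℓ : 𝓞 L) ∈ (τ • w).asIdeal := (natCast_mem_iff_of_under_eq hw' ℓ).mp hℓv
  rw [finprod_mem_setOf_under_eq h2L hτ hw]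
  -- traces on `K₁`
  set 𝔮 : HeightOneSpectrum (𝓞 K₁) := w.under (𝓞 K₁) with h𝔮
  have hℓ𝔮 : (ℓ : 𝓞 K₁) ∈ 𝔮.asIdeal := (natCast_mem_iff_of_under_eq (K := K₁) rfl ℓ).mpr hℓw
  have hτ𝔮 : (τ • w).under (𝓞 K₁) = c • 𝔮 := by
    rw [under_smul_eq_restrictNormal_smul_under (F := ℚ) (K₁ := K₁) τ w, hτc]
  have hℓc𝔮 : (ℓ : 𝓞 K₁) ∈ (c • 𝔮).asIdeal := (natCast_mem_iff_of_under_eq (K := K₁) hτ𝔮 ℓ).mpr hℓw'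
  -- absolute norms
  have hNw : Ideal.absNorm w.asIdeal = q ^ w.asIdeal.inertiaDeg (𝓞 K) := absNorm_eq_pow_inertiaDeg_under hw
  have hNw₁ : Ideal.absNorm w.asIdeal = Ideal.absNorm 𝔮.asIdeal ^ w.asIdeal.inertiaDeg (𝓞 K₁) :=
    absNorm_eq_pow_inertiaDeg_under (K := K₁) rfl
  have hNτw : Ideal.absNorm (τ • w).asIdeal = Ideal.absNorm w.asIdeal := HeightOneSpectrum.absNorm_algEquiv_smul K τ w
  have hNτw₁ : Ideal.absNorm (τ • w).asIdeal = Ideal.absNorm (c • 𝔮).asIdeal ^ (τ • w).asIdeal.inertiaDeg (𝓞 K₁) :=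
    absNorm_eq_pow_inertiaDeg_under (K := K₁) hτ𝔮
  have hNc𝔮 : Ideal.absNorm (c • 𝔮).asIdeal = Ideal.absNorm 𝔮.asIdeal := HeightOneSpectrum.absNorm_algEquiv_smul ℚ c 𝔮
  by_cases hgood : W.HasGoodReductionAtPrime ℓ
  · -- GOOD `ℓ`: `e_v = ℓ`, `a_ℓ(f) = a_ℓ(W)`
    have hndvd : ¬ ℓ ∣ W.conductorNorm ℤ := fun h ↦ (W.dvd_conductorNorm_iff_not_hasGoodReductionAtPrime ℓ).mp h hgood
    rw [if_neg hndvd, cuspCoeff_eq_frobeniusTrace_of_isNewformOf_holds hf hgood]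
    obtain ⟨hψu, hsplit, hinert⟩ := hψgood ℓ hgood 𝔮 hℓ𝔮
    obtain ⟨hψu', -, -⟩ := hψgood ℓ hgood (c • 𝔮) hℓc𝔮
    have hN𝔮 := norm_valueAtUniformizer_eq_sqrt hψσ 𝔮
    have hNc𝔮' := norm_valueAtUniformizer_eq_sqrt hψσ (c • 𝔮)
    rw [hNc𝔮] at hNc𝔮'
    -- the values of `η` at `w` and `τw`
    have hηw : heckeValueExtZero (ψ.compRelNorm L) w = ψ.valueAtUniformizer 𝔮 ^ w.asIdeal.inertiaDeg (𝓞 K₁) := by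
      rw [heckeValueExtZero_of_isUnramifiedAt (ψ.compRelNorm_isUnramifiedAt hψu),
        HeckeCharacter.compRelNorm_valueAtUniformizer_eq_pow' ψ w hψu]
    have hηw' : heckeValueExtZero (ψ.compRelNorm L) (τ • w) =
        ψ.valueAtUniformizer (c • 𝔮) ^ (τ • w).asIdeal.inertiaDeg (𝓞 K₁) := by
      have hu' : ψ.IsUnramifiedAt ((τ • w).under (𝓞 K₁)) := by rw [hτ𝔮]; exact hψu'
      rw [heckeValueExtZero_of_isUnramifiedAt (ψ.compRelNorm_isUnramifiedAt hu'),
        HeckeCharacter.compRelNorm_valueAtUniformizer_eq_pow' ψ (τ • w) hu', hτ𝔮]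
    -- `N(𝔮) > 1`, `f(w|𝔮) ≥ 1`
    have hlt : 2 ≤ Ideal.absNorm 𝔮.asIdeal := by
      have h0 : Ideal.absNorm 𝔮.asIdeal ≠ 0 := fun h ↦ 𝔮.ne_bot (Ideal.absNorm_eq_zero_iff.mp h)
      have h1 : Ideal.absNorm 𝔮.asIdeal ≠ 1 := fun h ↦ 𝔮.isPrime.ne_top (Ideal.absNorm_eq_one_iff.mp h)
      omega
    set m : ℕ := w.asIdeal.inertiaDeg (𝓞 K₁) with hm
    have hm0 : 0 < m := by
      haveI := w.isPrime
      exact Ideal.inertiaDeg_pos w.asIdeal (𝓞 K₁)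
    -- `f(τw|c𝔮) = f(w|𝔮)` (compare absolute norms)
    have hm' : (τ • w).asIdeal.inertiaDeg (𝓞 K₁) = m := by
      have h1 : Ideal.absNorm 𝔮.asIdeal ^ (τ • w).asIdeal.inertiaDeg (𝓞 K₁) = Ideal.absNorm 𝔮.asIdeal ^ m := by
        conv_lhs => rw [← hNc𝔮, ← hNτw₁, hNτw, hNw₁]
      exact Nat.pow_right_injective hlt h1
    rw [hm'] at hηw'
    by_cases hτw : τ • w = w
    · -- ONE place above `v`: `e(w|v) f(w|v) = 2`, `e = 1` (else `ℓ` would be bad), so `f = 2`, `N(v) = ℓ`, `c𝔮 = 𝔮`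
      rw [if_pos hτw]
      have hc𝔮 : c • 𝔮 = 𝔮 := by rw [← hτ𝔮, hτw]
      obtain ⟨ha, hψ𝔮⟩ := hinert hc𝔮
      have hef := ramificationIdx_mul_inertiaDeg_eq_two_of_smul_eq h2L hτ hw hτw
      have he1 : w.asIdeal.ramificationIdx (𝓞 K) = 1 := by
        by_contra hne
        have hdvd : w.asIdeal.ramificationIdx (𝓞 K) ∣ 2 := ⟨_, hef.symm⟩
        rcases (Nat.dvd_prime Nat.prime_two).mp hdvd with h | h
        · exact hne h
        · exact hramL ℓ w v hw hℓv h hgood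
      have hf2 : w.asIdeal.inertiaDeg (𝓞 K) = 2 := by rw [he1, one_mul] at hef; exact hef
      have hq1 : q = ℓ := hdeg w v hw hf2
      have hk1 : k = 1 := by
        have h : ℓ ^ k = ℓ ^ 1 := by rw [← hNv, hq1, pow_one]
        exact Nat.pow_right_injective hℓ.two_le h
      have hN𝔮2 : Ideal.absNorm 𝔮.asIdeal = ℓ ^ 2 := absNorm_eq_sq_of_eq_neg hN𝔮 hψ𝔮
      have hm1 : m = 1 := by
        have h1 : Ideal.absNorm 𝔮.asIdeal ^ m = Ideal.absNorm 𝔮.asIdeal ^ 1 := by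
          rw [pow_one, ← hNw₁, hNw, hf2, hq1, hN𝔮2]
        exact Nat.pow_right_injective hlt h1
      rw [hηw, hm1, pow_one, hψ𝔮, hf2, hk1, ha, Int.cast_zero, frobTracePow_one, pow_one]
      ring
    · -- TWO places above `v`: `e(w|v) = f(w|v) = 1`
      rw [if_neg hτw]
      obtain ⟨-, hf1⟩ := ramificationIdx_eq_one_and_inertiaDeg_eq_one_of_smul_ne h2L hτ hw hτw
      have hf1' : (τ • w).asIdeal.inertiaDeg (𝓞 K) = 1 := by rw [HeightOneSpectrum.inertiaDeg_algEquiv_smul, hf1]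
      rw [hf1, hf1', pow_one, hηw, hηw']
      by_cases hc𝔮 : c • 𝔮 = 𝔮
      · -- `ℓ` inert in `K₁`: `a_ℓ = 0`, `ψ(𝔮) = −ℓ`, `N(𝔮) = ℓ²`, so `k = 2`, `f(w|𝔮) = 1`
        obtain ⟨ha, hψ𝔮⟩ := hinert hc𝔮
        have hN𝔮2 : Ideal.absNorm 𝔮.asIdeal = ℓ ^ 2 := absNorm_eq_sq_of_eq_neg hN𝔮 hψ𝔮
        have hkm : k = 2 * m := by
          have h : ℓ ^ k = ℓ ^ (2 * m) := by rw [← hNv, pow_mul, ← hN𝔮2, ← hNw₁, hNw, hf1, pow_one]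
          exact Nat.pow_right_injective hℓ.two_le h
        have hm1 : m = 1 := by omega
        have hk2' : k = 2 := by omega
        rw [hc𝔮, hm1, pow_one, hψ𝔮, hk2', ha, Int.cast_zero, frobTracePow_two]
        ring
      · -- `ℓ` split in `K₁`: `ψ(𝔮) + ψ(c𝔮) = a_ℓ`, `ψ(𝔮)ψ(c𝔮) = ℓ`, `N(𝔮) = ℓ`, so `f(w|𝔮) = k`
        obtain ⟨hsum, hprod⟩ := hsplit hc𝔮
        have hN𝔮1 : Ideal.absNorm 𝔮.asIdeal = ℓ := absNorm_eq_of_mul_eq hN𝔮 hNc𝔮' hprod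
        have hmk : m = k := by
          have h : ℓ ^ m = ℓ ^ k := by rw [← hNv, ← hN𝔮1, ← hNw₁, hNw, hf1, pow_one]
          exact Nat.pow_right_injective hℓ.two_le h
        rw [hmk, ← hsum, ← hprod, frobTracePow_eq_pow_add_pow]
        ring
  · -- BAD `ℓ`: both sides are `1`
    have hdvd : ℓ ∣ W.conductorNorm ℤ := (W.dvd_conductorNorm_iff_not_hasGoodReductionAtPrime ℓ).mpr hgood
    rw [if_pos hdvd, cuspCoeff_eq_zero_of_hasCM_of_not_good hCM hgood hf, frobTracePow_zero_zero hk0, zero_pow hk0.ne',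
      heckeValueExtZero_of_not_isUnramifiedAt (hψbad ℓ hgood w hℓw),
      heckeValueExtZero_of_not_isUnramifiedAt (hψbad ℓ hgood (τ • w) hℓw')]
    split_ifs <;> ring

end Main

end Summit.BirchSwinnertonDyer.BirchSwinnertonDyer.Theorems.BiquadraticEisensteinDescentEisensteinHeartFlatCMInertBadKPrimeDeuringOverKPrime

end
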